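import Summits.QuantumFields.YangMills.Theorems.FradkinShenkerFlowFiniteSusceptibilityWeakCouplingPolarisation
import HarnessLib

/-!
# Crux `FiniteSusceptibilityWeakCoupling` (stmt-QuantumFields-9442), line `purity-rate-split` —
# automorphism sectors of the torus Wilson state (charge conjugation): invariance, selection rule, parity cut

The purity half `NoEvenLongRangeOrder` (item stmt-QuantumFields-18060) and the rate half
`DecorrelationForcesSummability` (item stmt-QuantumFields-18061) of the crux
`Summit.QuantumFields.YangMills.Theses.FradkinShenkerFlow.FiniteSusceptibilityWeakCoupling` both meet the
"outer-automorphism / charge-conjugation sector" of `STRATEGY-CENSUS.md` §S⁺8 (enemy: spontaneous breaking of `C` at weak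
coupling) and §N10 (the `U(1)₄` counter-mechanism of the rate half lives in the `C`-odd sector). Lead c21 typed and cut
the purity half along the spatial AXIS REFLECTIONS (`…SelectionRule`, `…Polarisation`, `…AxisParity`); this file does
the same for every GLOBAL AUTOMORPHISM of the gauge group acting link-wise — in particular for charge conjugation
`U_e ↦ Ū_e` of `SU(N)` — for every compact `G`, every torus side `L` and EVERY real `β`:

* `AutSector.map_haarProbability` — a bi-continuous group automorphism `φ : G ≃* G` preserves the normalised Haar
  measure (uniqueness of the Haar probability measure);
* `AutSector.wilsonAction_aut` / `AutSector.wilsonMeasure_map_aut` / `AutSector.measurePreserving_aut` — if the Wilson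
  character is `φ`-invariant, `Re tr ρ(φ g) = Re tr ρ(g)`, then the link-wise map `U ↦ φ ∘ U` preserves the Wilson action
  and the torus Wilson state `wilsonMeasure L ρ β` (product Haar is preserved factor-wise, the density is invariant);
* `AutSector.integral_eq_zero_of_aut_odd` — a `φ`-odd function of the torus gauge field has zero mean;
* `stub_automorphismSelectionRule` (registered on stmt-QuantumFields-9442) — **selection rule**: a `φ`-even species `P`
  and a `φ`-odd species `M` have identically vanishing connected time-correlations `latticeConnectedCorr r.ρ β (2S+1) P M n`
  and `… M P n` (the link-wise map commutes with the periodic lift and with all lattice translations);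
* `AutSector.four_mul_autocorr_eq` — for an INVOLUTIVE `φ` (charge conjugation) and `P = A + A∘φ`, `M = A − A∘φ`:
  `4·K(A,A) = K(P,P) + K(M,M)` (polarisation `…Polarisation.four_mul_corr_eq` + the selection rule), and
  `AutSector.evenClause_of_parts` — the clause of item 18060 for `A` follows from the clauses of its `φ`-even and `φ`-odd
  parts: the purity half CUTS LOSSLESSLY into the `φ`-even and the `φ`-odd sector (both parts stay `Θ`-even when `φ`
  commutes with the time reflection, as every link-wise automorphism does);
* `AutSector.exists_suConj` — the instance: on `SU(N)` entrywise complex conjugation IS such a `φ` (a bi-continuous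
  involutive automorphism with `(φ g : matrix) = ḡ`) and the fundamental Wilson character `Re tr g` is `φ`-invariant, so all
  of the above applies to `SU(N)` lattice gauge theory with the Wilson action at every `β`. For `SU(2)` the `φ`-odd sector is
  EMPTY (`…SU2ConjugationEven.su2_species_conj_even`: conjugation is inner); for `SU(N ≥ 3)` it is the genuine `C`-odd sector.

Nothing here is an engine for either half (census §S⁺8: `C`-breaking has "no positivity, no mechanism"); it is the typed
carrier of the `C`-sector bookkeeping, kernel-checked, `--supports` the crux. Mathlib + tree only; no named unproved facts.
-/

set_option autoImplicit false

noncomputable section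

open MeasureTheory ProbabilityTheory Finset
open Literature.MathematicalPhysics.QuantumFieldTheory hiding Site ZdEdge
open Literature.MathematicalPhysics.QuantumLattice
open Literature.Probability.LatticeModels hiding configShift configShift_apply

namespace Summit.QuantumFields.YangMills.Theorems.FiniteSusceptibilityWeakCoupling

namespace AutSector

section Haar

variable {G : Type} [Group G] [TopologicalSpace G] [IsTopologicalGroup G] [CompactSpace G]
  [MeasurableSpace G] [BorelSpace G]

/-- **A bi-continuous automorphism of a compact group preserves the Haar probability measure**: its image measure is
again a Haar probability measure, and Haar probability measures are unique. [folklore] -/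
theorem map_haarProbability (φ : G ≃* G) (hφ : Continuous φ) (hφs : Continuous φ.symm) :
    (haarProbability G).map φ = haarProbability G := by
  haveI : Measure.IsHaarMeasure (haarProbability G) := by
    unfold haarProbability; infer_instance
  haveI : Measure.IsHaarMeasure ((haarProbability G).map φ) := φ.isHaarMeasure_map (haarProbability G) hφ hφs
  haveI : IsProbabilityMeasure ((haarProbability G).map φ) :=
    Measure.isProbabilityMeasure_map hφ.measurable.aemeasurable
  exact Measure.isHaarMeasure_eq_of_isProbabilityMeasure _ _

end Haar

section Torus

variable {d L N : ℕ} {G : Type} [Group G]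

/-- The plaquette holonomy of the link-wise image `φ ∘ U` is `φ` of the plaquette holonomy. [folklore] -/
theorem plaquetteHolonomy_aut (φ : G ≃* G) (U : GaugeConfig d L G)
    (x : Literature.MathematicalPhysics.QuantumFieldTheory.Site d L) (i j : Fin d) :
    plaquetteHolonomy (fun e => φ (U e)) x i j = φ (plaquetteHolonomy U x i j) := by
  simp only [plaquetteHolonomy, map_mul, map_inv]

/-- **The Wilson action is invariant under a character-preserving global automorphism** acting link-wise. [folklore] -/
theorem wilsonAction_aut [NeZero L] (ρ : G →* Matrix (Fin N) (Fin N) ℂ) (φ : G ≃* G)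
    (hρφ : ∀ g, (ρ (φ g)).trace.re = (ρ g).trace.re) (U : GaugeConfig d L G) :
    wilsonAction ρ (fun e => φ (U e)) = wilsonAction ρ U := by
  unfold wilsonAction
  refine Finset.sum_congr rfl fun p _ => ?_
  rw [plaquetteHolonomy_aut, hρφ]

variable [TopologicalSpace G] [MeasurableSpace G] [BorelSpace G]

/-- The link-wise automorphism as a measurable equivalence of torus configurations acts as `U ↦ φ ∘ U`. -/
theorem arrowCongr'_apply (φ : G ≃* G) (hφ : Continuous φ) (hφs : Continuous φ.symm) (U : GaugeConfig d L G) :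
    MeasurableEquiv.arrowCongr' (Equiv.refl (Edge d L)) ((Homeomorph.mk φ.toEquiv hφ hφs).toMeasurableEquiv) U =
      fun e => φ (U e) := rfl

variable [IsTopologicalGroup G] [CompactSpace G]

/-- **Product Haar is preserved by the link-wise automorphism.** [folklore] -/
theorem pi_map_aut [NeZero L] (φ : G ≃* G) (hφ : Continuous φ) (hφs : Continuous φ.symm) :
    (Measure.pi fun _ : Edge d L => haarProbability G).map
        (MeasurableEquiv.arrowCongr' (Equiv.refl (Edge d L)) ((Homeomorph.mk φ.toEquiv hφ hφs).toMeasurableEquiv)) =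
      Measure.pi fun _ : Edge d L => haarProbability G :=
  (measurePreserving_arrowCongr' (fun _ : Edge d L => haarProbability G) (fun _ : Edge d L => haarProbability G)
    (Equiv.refl (Edge d L)) ((Homeomorph.mk φ.toEquiv hφ hφs).toMeasurableEquiv)
    fun _ => ⟨(Homeomorph.mk φ.toEquiv hφ hφs).toMeasurableEquiv.measurable, map_haarProbability φ hφ hφs⟩).map_eq

/-- **The torus Wilson state is invariant under a character-preserving global automorphism acting link-wise**
(every side `L`, every real `β`): `(wilsonMeasure L ρ β) ∘ (U ↦ φ ∘ U)⁻¹ = wilsonMeasure L ρ β`. [folklore] -/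
theorem wilsonMeasure_map_aut [NeZero L] (ρ : G →* Matrix (Fin N) (Fin N) ℂ) (β : ℝ) (φ : G ≃* G)
    (hφ : Continuous φ) (hφs : Continuous φ.symm) (hρφ : ∀ g, (ρ (φ g)).trace.re = (ρ g).trace.re) :
    (wilsonMeasure (d := d) (L := L) ρ β).map
        (MeasurableEquiv.arrowCongr' (Equiv.refl (Edge d L)) ((Homeomorph.mk φ.toEquiv hφ hφs).toMeasurableEquiv)) =
      wilsonMeasure (d := d) (L := L) ρ β := by
  have hπ := pi_map_aut (d := d) (L := L) φ hφ hφs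
  simp only [wilsonMeasure, Measure.map_smul, wilsonWeight]
  rw [withDensity_map_of_measurableEquiv _ _ _ hπ]
  intro U
  rw [arrowCongr'_apply, wilsonAction_aut ρ φ hρφ]

/-- The link-wise automorphism `U ↦ φ ∘ U` is a measure-preserving map of the torus Wilson state. [folklore] -/
theorem measurePreserving_aut [NeZero L] (ρ : G →* Matrix (Fin N) (Fin N) ℂ) (β : ℝ) (φ : G ≃* G)
    (hφ : Continuous φ) (hφs : Continuous φ.symm) (hρφ : ∀ g, (ρ (φ g)).trace.re = (ρ g).trace.re) :
    MeasurePreserving (fun U : GaugeConfig d L G => fun e => φ (U e))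
      (wilsonMeasure (d := d) (L := L) ρ β) (wilsonMeasure (d := d) (L := L) ρ β) := by
  have h : MeasurePreserving
      (MeasurableEquiv.arrowCongr' (Equiv.refl (Edge d L)) ((Homeomorph.mk φ.toEquiv hφ hφs).toMeasurableEquiv))
      (wilsonMeasure (d := d) (L := L) ρ β) (wilsonMeasure (d := d) (L := L) ρ β) :=
    ⟨MeasurableEquiv.measurable _, wilsonMeasure_map_aut ρ β φ hφ hφs hρφ⟩
  exact h

/-- **Change of variables `U ↦ φ ∘ U` under the torus Wilson state.** [folklore] -/
theorem integral_comp_aut [NeZero L] (ρ : G →* Matrix (Fin N) (Fin N) ℂ) (β : ℝ) (φ : G ≃* G)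
    (hφ : Continuous φ) (hφs : Continuous φ.symm) (hρφ : ∀ g, (ρ (φ g)).trace.re = (ρ g).trace.re)
    (g : GaugeConfig d L G → ℝ) :
    ∫ U, g (fun e => φ (U e)) ∂(wilsonMeasure (d := d) (L := L) ρ β) =
      ∫ U, g U ∂(wilsonMeasure (d := d) (L := L) ρ β) :=
  (measurePreserving_aut ρ β φ hφ hφs hρφ).integral_comp
    (MeasurableEquiv.arrowCongr' (Equiv.refl (Edge d L))
      ((Homeomorph.mk φ.toEquiv hφ hφs).toMeasurableEquiv)).measurableEmbedding g

/-- **A `φ`-odd function of the torus gauge field has zero mean.** [folklore] -/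
theorem integral_eq_zero_of_aut_odd [NeZero L] (ρ : G →* Matrix (Fin N) (Fin N) ℂ) (β : ℝ) (φ : G ≃* G)
    (hφ : Continuous φ) (hφs : Continuous φ.symm) (hρφ : ∀ g, (ρ (φ g)).trace.re = (ρ g).trace.re)
    (g : GaugeConfig d L G → ℝ) (hg : ∀ U, g (fun e => φ (U e)) = -g U) :
    ∫ U, g U ∂(wilsonMeasure (d := d) (L := L) ρ β) = 0 := by
  have h := integral_comp_aut ρ β φ hφ hφs hρφ g
  simp_rw [hg, integral_neg] at h
  linarith

end Torus

section Lift

variable {d : ℕ} {G : Type} [Group G]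

/-- The periodic lift commutes with the link-wise automorphism. -/
theorem torusLift_aut (φ : G ≃* G) (L : ℕ) (U : GaugeConfig d L G) :
    torusLift L (fun e => φ (U e)) = fun e => φ (torusLift L U e) := rfl

variable [MeasurableSpace G]

/-- Lattice translations commute with the link-wise automorphism. -/
theorem configShift_aut (φ : G ≃* G) (v : Literature.Probability.LatticeModels.Site d) (V : LGConfig d G) :
    configShift v (fun e => φ (V e)) = fun e => φ (configShift v V e) := by
  funext e
  simp only [Literature.MathematicalPhysics.QuantumLattice.configShift_apply]

end Lift

end AutSector

/-- **Registered stub `stub_automorphismSelectionRule`** of item stmt-QuantumFields-9442, line `purity-rate-split`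
(signature verbatim, fully qualified) — **the automorphism selection rule**: for every compact `G`, every lattice
representation `r`, every real `β` and every bi-continuous automorphism `φ` of `G` preserving the Wilson character of `r`
(`Re tr r.ρ (φ g) = Re tr r.ρ g`; e.g. charge conjugation of `SU(N)`), a `φ`-even species `P` and a `φ`-odd species `M`
have identically vanishing connected time-correlations in both orders, on every odd torus and at every lag. The three
integrals of `latticeConnectedCorr` have `φ`-odd integrands (`AutSector.torusLift_aut`, `AutSector.configShift_aut`) and
vanish (`AutSector.integral_eq_zero_of_aut_odd`). [folklore] -/
theorem stub_automorphismSelectionRule : ∀ (G : Type) [Group G] [TopologicalSpace G] [IsTopologicalGroup G] [CompactSpace G] [MeasurableSpace G] [BorelSpace G] (r : Literature.MathematicalPhysics.QuantumFieldTheory.LatticeRep G) (β : ℝ) (φ : G ≃* G), Continuous φ → Continuous φ.symm → (∀ g, ((r.ρ (φ g)).trace).re = ((r.ρ g).trace).re) → ∀ P M : Literature.MathematicalPhysics.QuantumFieldTheory.YMSpecies G, (∀ V, P.F (fun e => φ (V e)) = P.F V) → (∀ V, M.F (fun e => φ (V e)) = -M.F V) → ∀ S n : ℕ, Literature.MathematicalPhysics.QuantumFieldTheory.latticeConnectedCorr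 r.ρ β (2 * S + 1) P.F M.F n = 0 ∧ Literature.MathematicalPhysics.QuantumFieldTheory.latticeConnectedCorr r.ρ β (2 * S + 1) M.F P.F n = 0 := by
  intro G _ _ _ _ _ _ r β φ hφ hφs hρφ P M hP hM S n
  have h1 : ∫ U, P.F (torusLift (2 * S + 1) U) *
      M.F (configShift (-Pi.single 0 (n : ℤ)) (torusLift (2 * S + 1) U))
        ∂(wilsonMeasure (d := 4) (L := 2 * S + 1) r.ρ β) = 0 := by
    refine AutSector.integral_eq_zero_of_aut_odd r.ρ β φ hφ hφs hρφ _ fun U => ?_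
    rw [AutSector.torusLift_aut, AutSector.configShift_aut, hP, hM]
    ring
  have h2 : ∫ U, M.F (torusLift (2 * S + 1) U) *
      P.F (configShift (-Pi.single 0 (n : ℤ)) (torusLift (2 * S + 1) U))
        ∂(wilsonMeasure (d := 4) (L := 2 * S + 1) r.ρ β) = 0 := by
    refine AutSector.integral_eq_zero_of_aut_odd r.ρ β φ hφ hφs hρφ _ fun U => ?_
    rw [AutSector.torusLift_aut, AutSector.configShift_aut, hM, hP]
    ring
  have h3 : ∫ U, M.F (torusLift (2 * S + 1) U) ∂(wilsonMeasure (d := 4) (L := 2 * S + 1) r.ρ β) = 0 := by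
    refine AutSector.integral_eq_zero_of_aut_odd r.ρ β φ hφ hφs hρφ _ fun U => ?_
    rw [AutSector.torusLift_aut, hM]
  unfold latticeConnectedCorr
  rw [h1, h2, h3, mul_zero, zero_mul, sub_zero]
  exact ⟨rfl, rfl⟩

namespace AutSector

section Cut

variable {G : Type} [Group G] [TopologicalSpace G] [IsTopologicalGroup G] [CompactSpace G]
  [MeasurableSpace G] [BorelSpace G]

/-- **Polarisation along an involutive automorphism**: if `φ` is an involution preserving the Wilson character and
`P = A + A∘φ`, `M = A − A∘φ` (as species), then `4·K(A,A) = K(P,P) + K(M,M)` on every odd torus, at every lag and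
every real `β` — the cross terms die by the selection rule. [folklore] -/
theorem four_mul_autocorr_eq (r : LatticeRep G) (β : ℝ) (φ : G ≃* G) (hφ : Continuous φ)
    (hφs : Continuous φ.symm) (hρφ : ∀ g, (r.ρ (φ g)).trace.re = (r.ρ g).trace.re)
    (hφ2 : Function.Involutive φ) (A P M : YMSpecies G)
    (hP : ∀ V, P.F V = A.F V + A.F (fun e => φ (V e))) (hM : ∀ V, M.F V = A.F V - A.F (fun e => φ (V e)))
    (S n : ℕ) :
    4 * latticeConnectedCorr r.ρ β (2 * S + 1) A.F A.F n =
      latticeConnectedCorr r.ρ β (2 * S + 1) P.F P.F n + latticeConnectedCorr r.ρ β (2 * S + 1) M.F M.F n := by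
  have hφφ : ∀ V : LGConfig 4 G, (fun e => φ ((fun e' => φ (V e')) e)) = V := fun V => funext fun e => hφ2 (V e)
  have hPe : ∀ V, P.F (fun e => φ (V e)) = P.F V := fun V => by rw [hP, hP, hφφ]; ring
  have hMo : ∀ V, M.F (fun e => φ (V e)) = -M.F V := fun V => by rw [hM, hM, hφφ]; ring
  have hsum : ∀ V, P.F V + M.F V = 2 * A.F V := fun V => by rw [hP, hM]; ring
  obtain ⟨hPM, hMP⟩ := stub_automorphismSelectionRule G r β φ hφ hφs hρφ P M hPe hMo S n
  rw [Polarisation.four_mul_corr_eq r β A P M hsum S n, hPM, hMP, add_zero, add_zero]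

/-- **The clause of item 18060 for `A` follows from the clauses of its `φ`-even and `φ`-odd parts** (fixed `(G, r, β)`,
`φ` an involutive character-preserving bi-continuous automorphism): uniform time-axis decorrelation of `P = A + A∘φ` and of
`M = A − A∘φ` on the odd tori gives that of `A`, since `4·K(A,A) = K(P,P) + K(M,M)`. (The converse is immediate: `P` and
`M` are species, `Θ`-even whenever `A` is and `φ` commutes with `Θ`.) [folklore] -/
theorem evenClause_of_parts (r : LatticeRep G) (β : ℝ) (φ : G ≃* G) (hφ : Continuous φ)
    (hφs : Continuous φ.symm) (hρφ : ∀ g, (r.ρ (φ g)).trace.re = (r.ρ g).trace.re)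
    (hφ2 : Function.Involutive φ) (A P M : YMSpecies G)
    (hP : ∀ V, P.F V = A.F V + A.F (fun e => φ (V e))) (hM : ∀ V, M.F V = A.F V - A.F (fun e => φ (V e)))
    (hPc : ∀ ε : ℝ, 0 < ε → ∃ j₀ : ℕ, ∀ S j : ℕ, j₀ ≤ j → j ≤ S →
      |latticeConnectedCorr r.ρ β (2 * S + 1) P.F P.F j| ≤ ε)
    (hMc : ∀ ε : ℝ, 0 < ε → ∃ j₀ : ℕ, ∀ S j : ℕ, j₀ ≤ j → j ≤ S →
      |latticeConnectedCorr r.ρ β (2 * S + 1) M.F M.F j| ≤ ε) :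
    ∀ ε : ℝ, 0 < ε → ∃ j₀ : ℕ, ∀ S j : ℕ, j₀ ≤ j → j ≤ S →
      |latticeConnectedCorr r.ρ β (2 * S + 1) A.F A.F j| ≤ ε := by
  intro ε hε
  obtain ⟨jP, hjP⟩ := hPc ε hε
  obtain ⟨jM, hjM⟩ := hMc ε hε
  refine ⟨max jP jM, fun S j hj hjS => ?_⟩
  have h4 := four_mul_autocorr_eq r β φ hφ hφs hρφ hφ2 A P M hP hM S j
  have aP := hjP S j ((le_max_left _ _).trans hj) hjS
  have aM := hjM S j ((le_max_right _ _).trans hj) hjS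
  have habs : 4 * |latticeConnectedCorr r.ρ β (2 * S + 1) A.F A.F j| ≤
      |latticeConnectedCorr r.ρ β (2 * S + 1) P.F P.F j| + |latticeConnectedCorr r.ρ β (2 * S + 1) M.F M.F j| := by
    rw [show (4 : ℝ) * |latticeConnectedCorr r.ρ β (2 * S + 1) A.F A.F j| =
        |4 * latticeConnectedCorr r.ρ β (2 * S + 1) A.F A.F j| by
          rw [abs_mul, abs_of_pos (by norm_num : (0 : ℝ) < 4)], h4]
    exact abs_add_le _ _
  linarith

end Cut

section SUConj

/-- **Charge conjugation of `SU(N)` is an admissible automorphism**: there is a bi-continuous involutive group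
automorphism `φ` of `SU(N)` acting as entrywise complex conjugation, `(φ g : matrix) = ḡ`, and the fundamental Wilson
character `Re tr g` is `φ`-invariant. So `AutSector.wilsonMeasure_map_aut`, `stub_automorphismSelectionRule`,
`AutSector.four_mul_autocorr_eq` and `AutSector.evenClause_of_parts` apply to `SU(N)` lattice gauge theory with the
fundamental Wilson action at every `β`. [folklore] -/
theorem exists_suConj (N : ℕ) :
    ∃ φ : Matrix.specialUnitaryGroup (Fin N) ℂ ≃* Matrix.specialUnitaryGroup (Fin N) ℂ,
      Continuous φ ∧ Continuous φ.symm ∧ Function.Involutive φ ∧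
      (∀ g, (φ g : Matrix (Fin N) (Fin N) ℂ) = (g : Matrix (Fin N) (Fin N) ℂ).map star) ∧
      ∀ g, ((fundamentalRep (Fin N) (φ g)).trace).re = ((fundamentalRep (Fin N) g).trace).re := by
  -- entrywise conjugation preserves `SU(N)`
  have hmem : ∀ M : Matrix (Fin N) (Fin N) ℂ, M ∈ Matrix.specialUnitaryGroup (Fin N) ℂ →
      M.map star ∈ Matrix.specialUnitaryGroup (Fin N) ℂ := by
    intro M hM
    rw [Matrix.mem_specialUnitaryGroup_iff] at hM ⊢
    refine ⟨Matrix.map_star_mem_unitaryGroup_iff.mpr hM.1, ?_⟩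
    rw [Complex.star_def, ← RingHom.mapMatrix_apply, ← RingHom.map_det, hM.2, map_one]
  have hinv : ∀ M : Matrix (Fin N) (Fin N) ℂ, (M.map star).map star = M := fun M => by
    ext i j; simp
  let e : Matrix.specialUnitaryGroup (Fin N) ℂ ≃ Matrix.specialUnitaryGroup (Fin N) ℂ :=
    { toFun := fun g => ⟨(g : Matrix (Fin N) (Fin N) ℂ).map star, hmem _ g.prop⟩
      invFun := fun g => ⟨(g : Matrix (Fin N) (Fin N) ℂ).map star, hmem _ g.prop⟩
      left_inv := fun g => Subtype.ext (hinv _)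
      right_inv := fun g => Subtype.ext (hinv _) }
  let φ : Matrix.specialUnitaryGroup (Fin N) ℂ ≃* Matrix.specialUnitaryGroup (Fin N) ℂ :=
    { e with
      map_mul' := fun g h => Subtype.ext (by
        change ((g : Matrix (Fin N) (Fin N) ℂ) * h).map star = (g : Matrix _ _ ℂ).map star * (h : Matrix _ _ ℂ).map star
        rw [Complex.star_def]
        exact Matrix.map_mul) }
  have hcont : Continuous φ := by
    refine Continuous.subtype_mk ?_ _
    exact continuous_subtype_val.matrix_map continuous_star
  refine ⟨φ, hcont, ?_, fun g => Subtype.ext (hinv _), fun g => rfl, fun g => ?_⟩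
  · refine Continuous.subtype_mk ?_ _
    exact continuous_subtype_val.matrix_map continuous_star
  · change ((g : Matrix (Fin N) (Fin N) ℂ).map star).trace.re = (g : Matrix (Fin N) (Fin N) ℂ).trace.re
    simp only [Matrix.trace, Matrix.diag, Matrix.map_apply, Complex.re_sum, Complex.star_def, Complex.conj_re]

end SUConj

end AutSector

end Summit.QuantumFields.YangMills.Theorems.FiniteSusceptibilityWeakCoupling

end
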